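import Literature.Combinatorics.Hypergraph.FGKMTCoveringNibbleMoments
import HarnessLib

/-!
# Ford–Green–Konyagin–Maynard–Tao 2018, §5: one nibble — the one-step estimate (5.6) ⟹ (4.14) at level `m`

Topic `Literature/Combinatorics/Hypergraph`. Source: K. Ford, B. Green, S. Konyagin, J. Maynard, T. Tao,
*Long gaps between primes*, J. Amer. Math. Soc. 31 (2018) 65–105 = arXiv:1412.5029
[FordGreenKonyaginMaynardTao2018], §5 «Proof of covering theorem», pp. 20–21 (arXiv pp. 15–16):
the end of the inductive step.

For a nibble `𝔑 : NibbleData` and `#e ≤ s` this file PROVES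
`NibbleData.step : |E 1_{e⊆𝐖} Y_e(𝐖) − P_{m−1}(e) e^{−∑_{v∈e} d(v)/P_{m−1}(v)}| ≤ 20 G³ η^{1/6} · P_{m−1}(e) e^{−∑ d/P_{m−1}}`
(the left side is `P(e ⊆ V ∖ ⋃_{j≤m}⋃_i 𝐞'_i)` and `P_{m−1}(e)e^{−∑ d/P_{m−1}} = P_m(e)`): the typical
`W` (all `|M_v − d/p| ≤ Gη^{1/3}`, `Err_v ≤ G²η^{1/6}`) has mass `1 − O(Bd)` by Chebyshev (variance
bound of `FGKMTCoveringNibbleMoments`) and Markov, the `Y`-sandwich is evaluated there, and every error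
is shown to be `O(G³η^{1/6})` with explicit constants from `G¹⁸η·10¹² ≤ 1` (numerics section).
-/

noncomputable section

open Finset

namespace Literature.Combinatorics.Hypergraph

namespace FGKMTCovering

namespace NibbleData

variable {V ι Ω : Type*} [Fintype V] [DecidableEq V] [Fintype Ω] (𝔑 : NibbleData V ι Ω)

/-! ### Assembly of the one-step estimate (conclusion (5.6) at level `m`) -/

section Step

/-- The exponent `L(e) = ∑_{v ∈ e} d_{I_m}(v)/P_{m−1}(v)` (so that `P_m(e) = P_{m−1}(e) e^{−L(e)}`, (4.10)–(4.14)).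
[cite: FordGreenKonyaginMaynardTao2018, (4.10)–(4.14)] -/
def Lsum (e : Finset V) : ℝ := ∑ v ∈ e, normDegree 𝔑.μ 𝔑.T v / 𝔑.p v

/-- Chebyshev threshold `τ_M = G t` for `|M_v − d(v)/p(v)|`. [cite: FordGreenKonyaginMaynardTao2018, §5 (Lemma 4.1 applied after (5.8))] -/
def τM : ℝ := 𝔑.G * 𝔑.t

/-- Markov threshold `τ_E = G² u` for `Err_v`. [cite: FordGreenKonyaginMaynardTao2018, §5 (error terms)] -/
def τE : ℝ := 𝔑.G ^ 2 * 𝔑.u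

/-- The bad-event mass bound `Bd(e) = #e (P(e) ζ/τ_M² + κ^{-r}(2t + φ)D/τ_E)`.
[cite: FordGreenKonyaginMaynardTao2018, §5 (Lemma 4.1 applied after (5.8))] -/
def Bd (e : Finset V) : ℝ :=
  #e * (𝔑.P e * 𝔑.ζ / 𝔑.τM ^ 2 + 𝔑.θ⁻¹ * (2 * 𝔑.t + 𝔑.φ) * 𝔑.D / 𝔑.τE)

/-- [cite: FordGreenKonyaginMaynardTao2018, (4.10)–(4.14)] -/
theorem Lsum_nonneg (e : Finset V) : 0 ≤ 𝔑.Lsum e :=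
  Finset.sum_nonneg fun v _ => div_nonneg (𝔑.normDegree_nonneg v) (𝔑.p_pos v).le

/-- `L(e) ≤ #e D ≤ s D` ((4.12)). [cite: FordGreenKonyaginMaynardTao2018, (4.12)] -/
theorem Lsum_le {e : Finset V} (he : (#e : ℝ) ≤ 𝔑.s) : 𝔑.Lsum e ≤ 𝔑.s * 𝔑.D := by
  have h : ∀ v ∈ e, normDegree 𝔑.μ 𝔑.T v / 𝔑.p v ≤ 𝔑.D := fun v _ => by
    rw [div_le_iff₀ (𝔑.p_pos v)]; exact 𝔑.hdeg v
  calc 𝔑.Lsum e ≤ ∑ _v ∈ e, 𝔑.D := Finset.sum_le_sum h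
    _ = #e * 𝔑.D := by rw [Finset.sum_const, nsmul_eq_mul]
    _ ≤ 𝔑.s * 𝔑.D := mul_le_mul_of_nonneg_right he (le_trans zero_le_one 𝔑.hD)

/-- [cite: FordGreenKonyaginMaynardTao2018, §5] -/
theorem τM_pos : 0 < 𝔑.τM := mul_pos (lt_of_lt_of_le one_pos 𝔑.hG) 𝔑.t_pos

/-- [cite: FordGreenKonyaginMaynardTao2018, §5] -/
theorem τE_pos : 0 < 𝔑.τE := mul_pos (pow_pos (lt_of_lt_of_le one_pos 𝔑.hG) 2) 𝔑.u_pos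

/-- [cite: FordGreenKonyaginMaynardTao2018, §5] -/
theorem Bd_nonneg (e : Finset V) : 0 ≤ 𝔑.Bd e := by
  have := 𝔑.ζ_nonneg; have := 𝔑.φ_nonneg; have := 𝔑.t_pos; have := 𝔑.τM_pos; have := 𝔑.τE_pos
  have := 𝔑.P_pos e; have := 𝔑.hD; have hθi : 0 ≤ 𝔑.θ⁻¹ := inv_nonneg.2 𝔑.hθ0.le
  unfold Bd; positivity

/-- Mass of `{e ⊆ 𝐖} ∩ {τ_M < |M_v − d(v)/p(v)|}` is at most `P(e)ζ/τ_M²` (Chebyshev, Lemma 4.1).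
[cite: FordGreenKonyaginMaynardTao2018, §5 (Lemma 4.1 applied after (5.8))] -/
theorem mass_dev_M_le {v : V} {e : Finset V} (hve : v ∈ e) (he : (#e : ℝ) ≤ 𝔑.s) :
    ∑ ω ∈ univ.filter (fun ω => e ⊆ 𝔑.W ω ∧
        𝔑.τM < |𝔑.M v (𝔑.W ω) - normDegree 𝔑.μ 𝔑.T v / 𝔑.p v|), 𝔑.Λ ω ≤
      𝔑.P e * 𝔑.ζ / 𝔑.τM ^ 2 := by
  have h1 : ∑ ω ∈ univ.filter (fun ω => e ⊆ 𝔑.W ω ∧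
      𝔑.τM < |𝔑.M v (𝔑.W ω) - normDegree 𝔑.μ 𝔑.T v / 𝔑.p v|), 𝔑.Λ ω =
      ∑ ω ∈ univ.filter (fun ω => 𝔑.τM < |𝔑.M v (𝔑.W ω) - normDegree 𝔑.μ 𝔑.T v / 𝔑.p v|),
        𝔑.Λ ω * 𝔑.ind e ω := by
    rw [Finset.sum_filter, Finset.sum_filter]
    refine Finset.sum_congr rfl fun ω _ => ?_
    unfold ind
    by_cases h : e ⊆ 𝔑.W ω <;> simp [h]
  rw [h1]
  refine (weighted_chebyshev univ (fun ω => 𝔑.M v (𝔑.W ω)) (normDegree 𝔑.μ 𝔑.T v / 𝔑.p v)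
    𝔑.τM_pos (fun ω _ => mul_nonneg (𝔑.Λ_nonneg ω) (𝔑.ind_nonneg e ω))).trans ?_
  refine div_le_div_of_nonneg_right ?_ (sq_nonneg _)
  have := 𝔑.E_ind_sq_dev_le hve he
  simpa only [E, mul_assoc] using this

/-- Mass of `{τ_E < Err_v}` is at most `κ^{-r}(2t + φ)D/τ_E` (Markov).
[cite: FordGreenKonyaginMaynardTao2018, §5 (error terms, Lemma 5.1)] -/
theorem mass_Err_le (v : V) :
    ∑ ω ∈ univ.filter (fun ω => 𝔑.τE < 𝔑.Err v (𝔑.W ω)), 𝔑.Λ ω ≤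
      𝔑.θ⁻¹ * (2 * 𝔑.t + 𝔑.φ) * 𝔑.D / 𝔑.τE := by
  refine (weighted_markov univ (fun ω => 𝔑.τE < 𝔑.Err v (𝔑.W ω)) 𝔑.τE_pos
    (fun ω _ => 𝔑.Λ_nonneg ω) (fun ω _ => 𝔑.Err_nonneg v (𝔑.W ω)) (fun ω _ h => h.le)).trans ?_
  exact div_le_div_of_nonneg_right (𝔑.E_Err_le v) 𝔑.τE_pos.le

/-- The indicator of the bad event `{e ⊆ 𝐖} ∖ {all v ∈ e: |M_v − d/p| ≤ τ_M, Err_v ≤ τ_E}`.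
[cite: FordGreenKonyaginMaynardTao2018, §5 (the exceptional `W`)] -/
def badInd (e : Finset V) (ω : Ω) : ℝ :=
  if e ⊆ 𝔑.W ω ∧ ¬ (∀ v ∈ e, |𝔑.M v (𝔑.W ω) - normDegree 𝔑.μ 𝔑.T v / 𝔑.p v| ≤ 𝔑.τM ∧
      𝔑.Err v (𝔑.W ω) ≤ 𝔑.τE) then 1 else 0

/-- The indicator of the good event `{e ⊆ 𝐖, all v ∈ e: |M_v − d/p| ≤ τ_M, Err_v ≤ τ_E}`.
[cite: FordGreenKonyaginMaynardTao2018, §5 (the typical `W`)] -/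
def goodInd (e : Finset V) (ω : Ω) : ℝ :=
  if e ⊆ 𝔑.W ω ∧ (∀ v ∈ e, |𝔑.M v (𝔑.W ω) - normDegree 𝔑.μ 𝔑.T v / 𝔑.p v| ≤ 𝔑.τM ∧
      𝔑.Err v (𝔑.W ω) ≤ 𝔑.τE) then 1 else 0

/-- [cite: FordGreenKonyaginMaynardTao2018, §5] -/
theorem ind_eq_good_add_bad (e : Finset V) (ω : Ω) : 𝔑.ind e ω = 𝔑.goodInd e ω + 𝔑.badInd e ω := by
  unfold ind goodInd badInd
  by_cases h : e ⊆ 𝔑.W ω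
  · rw [if_pos h]
    by_cases h' : ∀ v ∈ e, |𝔑.M v (𝔑.W ω) - normDegree 𝔑.μ 𝔑.T v / 𝔑.p v| ≤ 𝔑.τM ∧
        𝔑.Err v (𝔑.W ω) ≤ 𝔑.τE
    · rw [if_pos ⟨h, h'⟩, if_neg (fun hh => hh.2 h')]; norm_num
    · rw [if_neg (fun hh => h' hh.2), if_pos ⟨h, h'⟩]; norm_num
  · rw [if_neg h, if_neg (fun hh => h hh.1), if_neg (fun hh => h hh.1)]; norm_num

/-- [cite: FordGreenKonyaginMaynardTao2018, §5] -/
theorem goodInd_nonneg (e : Finset V) (ω : Ω) : 0 ≤ 𝔑.goodInd e ω := by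
  unfold goodInd; split_ifs <;> norm_num

/-- [cite: FordGreenKonyaginMaynardTao2018, §5] -/
theorem badInd_nonneg (e : Finset V) (ω : Ω) : 0 ≤ 𝔑.badInd e ω := by
  unfold badInd; split_ifs <;> norm_num

/-- **The bad event is rare:** `E badInd ≤ Bd(e)` (union bound over `v ∈ e`, Chebyshev and Markov).
[cite: FordGreenKonyaginMaynardTao2018, §5 (Lemma 4.1 applied after (5.8))] -/
theorem E_badInd_le {e : Finset V} (he : (#e : ℝ) ≤ 𝔑.s) : 𝔑.E (𝔑.badInd e) ≤ 𝔑.Bd e := by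
  classical
  -- pointwise union bound
  set A : V → Ω → ℝ := fun v ω => if e ⊆ 𝔑.W ω ∧
      𝔑.τM < |𝔑.M v (𝔑.W ω) - normDegree 𝔑.μ 𝔑.T v / 𝔑.p v| then 1 else 0 with hA
  set B : V → Ω → ℝ := fun v ω => if 𝔑.τE < 𝔑.Err v (𝔑.W ω) then 1 else 0 with hB
  have hA0 : ∀ v ω, 0 ≤ A v ω := fun v ω => by simp only [hA]; split_ifs <;> norm_num
  have hB0 : ∀ v ω, 0 ≤ B v ω := fun v ω => by simp only [hB]; split_ifs <;> norm_num
  have hpt : ∀ ω, 𝔑.badInd e ω ≤ ∑ v ∈ e, (A v ω + B v ω) := by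
    intro ω
    unfold badInd
    split_ifs with h
    · obtain ⟨hsub, hnot⟩ := h
      push Not at hnot
      obtain ⟨v, hv, hbad⟩ := hnot
      have h1 : (1 : ℝ) ≤ A v ω + B v ω := by
        by_cases hM : |𝔑.M v (𝔑.W ω) - normDegree 𝔑.μ 𝔑.T v / 𝔑.p v| ≤ 𝔑.τM
        · have hE := hbad hM
          have : B v ω = 1 := by simp only [hB]; rw [if_pos hE]
          rw [this]; linarith [hA0 v ω]
        · have : A v ω = 1 := by simp only [hA]; rw [if_pos ⟨hsub, not_le.1 hM⟩]
          rw [this]; linarith [hB0 v ω]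
      exact h1.trans (Finset.single_le_sum (fun w _ => add_nonneg (hA0 w ω) (hB0 w ω)) hv)
    · exact Finset.sum_nonneg fun w _ => add_nonneg (hA0 w ω) (hB0 w ω)
  refine (𝔑.E_mono hpt).trans ?_
  rw [𝔑.E_sum]
  have hv : ∀ v ∈ e, 𝔑.E (fun ω => A v ω + B v ω) ≤
      𝔑.P e * 𝔑.ζ / 𝔑.τM ^ 2 + 𝔑.θ⁻¹ * (2 * 𝔑.t + 𝔑.φ) * 𝔑.D / 𝔑.τE := by
    intro v hve
    rw [𝔑.E_add]
    refine add_le_add ?_ ?_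
    · rw [← 𝔑.mass_eq_E]
      exact 𝔑.mass_dev_M_le hve he
    · rw [← 𝔑.mass_eq_E]
      exact 𝔑.mass_Err_le v
  calc ∑ v ∈ e, 𝔑.E (fun ω => A v ω + B v ω)
      ≤ ∑ _v ∈ e, (𝔑.P e * 𝔑.ζ / 𝔑.τM ^ 2 + 𝔑.θ⁻¹ * (2 * 𝔑.t + 𝔑.φ) * 𝔑.D / 𝔑.τE) :=
        Finset.sum_le_sum hv
    _ = 𝔑.Bd e := by rw [Finset.sum_const, nsmul_eq_mul, Bd]

/-- On the good event, `|S_e(W) − L(e)| ≤ #e(τ_M + τ_E)`.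
[cite: FordGreenKonyaginMaynardTao2018, §5 (main term `= (1 + O(…)) ∑_{v∈e} d(v)/P_{m−1}(v)`)] -/
theorem abs_Se_sub_Lsum_le {e : Finset V} {ω : Ω}
    (hgood : ∀ v ∈ e, |𝔑.M v (𝔑.W ω) - normDegree 𝔑.μ 𝔑.T v / 𝔑.p v| ≤ 𝔑.τM ∧
      𝔑.Err v (𝔑.W ω) ≤ 𝔑.τE) :
    |𝔑.Se e (𝔑.W ω) - 𝔑.Lsum e| ≤ #e * (𝔑.τM + 𝔑.τE) := by
  have h1 := 𝔑.abs_Se_sub_sum_M_le (e := e) (𝔑.W ω)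
  have h2 : |∑ v ∈ e, 𝔑.M v (𝔑.W ω) - 𝔑.Lsum e| ≤ ∑ _v ∈ e, 𝔑.τM := by
    rw [Lsum, ← Finset.sum_sub_distrib]
    exact (Finset.abs_sum_le_sum_abs _ _).trans (Finset.sum_le_sum fun v hv => (hgood v hv).1)
  have h3 : ∑ v ∈ e, 𝔑.Err v (𝔑.W ω) ≤ ∑ _v ∈ e, 𝔑.τE := Finset.sum_le_sum fun v hv => (hgood v hv).2
  rw [Finset.sum_const, nsmul_eq_mul] at h2 h3
  calc |𝔑.Se e (𝔑.W ω) - 𝔑.Lsum e|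
      ≤ |𝔑.Se e (𝔑.W ω) - ∑ v ∈ e, 𝔑.M v (𝔑.W ω)| + |∑ v ∈ e, 𝔑.M v (𝔑.W ω) - 𝔑.Lsum e| :=
        abs_sub_le _ _ _
    _ ≤ #e * 𝔑.τE + #e * 𝔑.τM := add_le_add (h1.trans h3) h2
    _ = #e * (𝔑.τM + 𝔑.τE) := by ring

/-- **Upper bound for `E 1_{e ⊆ 𝐖} Y(𝐖)`:** `≤ e^{−L(e) + s(τ_M+τ_E) + γ}(1 + η)P(e) + Bd(e)`.
[cite: FordGreenKonyaginMaynardTao2018, §5 (displays (5.4)–(5.6))] -/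
theorem E_ind_Y_le {e : Finset V} (he : (#e : ℝ) ≤ 𝔑.s) :
    𝔑.E (fun ω => 𝔑.ind e ω * 𝔑.Y e (𝔑.W ω)) ≤
      Real.exp (-𝔑.Lsum e + 𝔑.s * (𝔑.τM + 𝔑.τE) + 𝔑.γ) * ((1 + 𝔑.η) * 𝔑.P e) + 𝔑.Bd e := by
  set c := Real.exp (-𝔑.Lsum e + 𝔑.s * (𝔑.τM + 𝔑.τE) + 𝔑.γ) with hc
  have hc0 : 0 ≤ c := (Real.exp_pos _).le
  have hpt : ∀ ω, 𝔑.ind e ω * 𝔑.Y e (𝔑.W ω) ≤ c * 𝔑.goodInd e ω + 𝔑.badInd e ω := by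
    intro ω
    have hY0 := 𝔑.Y_nonneg (𝔑.W ω) he
    have hY1 := 𝔑.Y_le_one (𝔑.W ω) he
    unfold ind goodInd badInd
    by_cases h : e ⊆ 𝔑.W ω
    · rw [if_pos h, one_mul]
      by_cases h' : ∀ v ∈ e, |𝔑.M v (𝔑.W ω) - normDegree 𝔑.μ 𝔑.T v / 𝔑.p v| ≤ 𝔑.τM ∧
          𝔑.Err v (𝔑.W ω) ≤ 𝔑.τE
      · rw [if_pos ⟨h, h'⟩, if_neg (fun hh => hh.2 h'), mul_one, add_zero]
        refine (𝔑.Y_le_exp (𝔑.W ω) he).trans ?_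
        rw [hc, Real.exp_le_exp]
        have h1 := (abs_le.1 (𝔑.abs_Se_sub_Lsum_le h')).1
        have h2 : #e * (𝔑.τM + 𝔑.τE) ≤ 𝔑.s * (𝔑.τM + 𝔑.τE) :=
          mul_le_mul_of_nonneg_right he (by linarith [𝔑.τM_pos, 𝔑.τE_pos])
        linarith
      · rw [if_neg (fun hh => h' hh.2), if_pos ⟨h, h'⟩, mul_zero, zero_add]
        exact hY1
    · rw [if_neg h, if_neg (fun hh => h hh.1), if_neg (fun hh => h hh.1), zero_mul, mul_zero,
        add_zero]
  refine (𝔑.E_mono hpt).trans ?_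
  rw [𝔑.E_add, 𝔑.E_mul_left]
  have hgood : 𝔑.E (𝔑.goodInd e) ≤ (1 + 𝔑.η) * 𝔑.P e := by
    refine le_trans (𝔑.E_mono fun ω => ?_) (𝔑.E_ind_le (by linarith [𝔑.hr] : (#e : ℝ) ≤ 𝔑.s + 2 * 𝔑.r))
    rw [𝔑.ind_eq_good_add_bad]
    linarith [𝔑.badInd_nonneg e ω]
  have hbad := 𝔑.E_badInd_le he
  nlinarith [mul_le_mul_of_nonneg_left hgood hc0]

/-- **Lower bound for `E 1_{e ⊆ 𝐖} Y(𝐖)`:** `≥ e^{−(1 + 2α)(L(e) + s(τ_M+τ_E))}((1 − η)P(e) − Bd(e))`.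
[cite: FordGreenKonyaginMaynardTao2018, §5 (displays (5.4)–(5.6))] -/
theorem le_E_ind_Y {e : Finset V} (he : (#e : ℝ) ≤ 𝔑.s) :
    Real.exp (-((1 + 2 * 𝔑.α) * (𝔑.Lsum e + 𝔑.s * (𝔑.τM + 𝔑.τE)))) * ((1 - 𝔑.η) * 𝔑.P e - 𝔑.Bd e) ≤
      𝔑.E (fun ω => 𝔑.ind e ω * 𝔑.Y e (𝔑.W ω)) := by
  set c := Real.exp (-((1 + 2 * 𝔑.α) * (𝔑.Lsum e + 𝔑.s * (𝔑.τM + 𝔑.τE)))) with hc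
  have hc0 : 0 ≤ c := (Real.exp_pos _).le
  have hα1 : 0 ≤ 1 + 2 * 𝔑.α := by linarith [𝔑.α_nonneg]
  have hpt : ∀ ω, c * 𝔑.goodInd e ω ≤ 𝔑.ind e ω * 𝔑.Y e (𝔑.W ω) := by
    intro ω
    have hY0 := 𝔑.Y_nonneg (𝔑.W ω) he
    unfold ind goodInd
    by_cases h : e ⊆ 𝔑.W ω
    · rw [if_pos h, one_mul]
      by_cases h' : ∀ v ∈ e, |𝔑.M v (𝔑.W ω) - normDegree 𝔑.μ 𝔑.T v / 𝔑.p v| ≤ 𝔑.τM ∧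
          𝔑.Err v (𝔑.W ω) ≤ 𝔑.τE
      · rw [if_pos ⟨h, h'⟩, mul_one]
        refine le_trans ?_ (𝔑.exp_le_Y (𝔑.W ω) he)
        rw [hc, Real.exp_le_exp, neg_le_neg_iff]
        have h1 := (abs_le.1 (𝔑.abs_Se_sub_Lsum_le h')).2
        have h2 : #e * (𝔑.τM + 𝔑.τE) ≤ 𝔑.s * (𝔑.τM + 𝔑.τE) :=
          mul_le_mul_of_nonneg_right he (by linarith [𝔑.τM_pos, 𝔑.τE_pos])
        exact mul_le_mul_of_nonneg_left (by linarith) hα1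
      · rw [if_neg (fun hh => h' hh.2), mul_zero]
        exact hY0
    · rw [if_neg h, if_neg (fun hh => h hh.1), mul_zero, zero_mul]
  refine le_trans ?_ (𝔑.E_mono hpt)
  rw [𝔑.E_mul_left]
  refine mul_le_mul_of_nonneg_left ?_ hc0
  have hgood : (1 - 𝔑.η) * 𝔑.P e - 𝔑.Bd e ≤ 𝔑.E (𝔑.goodInd e) := by
    have h1 := 𝔑.le_E_ind (by linarith [𝔑.hr] : (#e : ℝ) ≤ 𝔑.s + 2 * 𝔑.r)
    have h2 := 𝔑.E_badInd_le he
    have h3 : 𝔑.E (𝔑.ind e) = 𝔑.E (𝔑.goodInd e) + 𝔑.E (𝔑.badInd e) := by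
      rw [← 𝔑.E_add]
      exact congrArg 𝔑.E (funext fun ω => 𝔑.ind_eq_good_add_bad e ω)
    linarith
  exact hgood

end Step

/-! ### Numerics: everything is `O(G³ u)` -/

section Numerics

/-- The basic error unit `E₀ = G³ u = G³ η^{1/6}`. [cite: FordGreenKonyaginMaynardTao2018, §5 (choice of error exponents)] -/
def E0 : ℝ := 𝔑.G ^ 3 * 𝔑.u

/-- [cite: FordGreenKonyaginMaynardTao2018, §5] -/
theorem G_pos : 0 < 𝔑.G := lt_of_lt_of_le one_pos 𝔑.hG

/-- [cite: FordGreenKonyaginMaynardTao2018, §5] -/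
theorem E0_pos : 0 < 𝔑.E0 := mul_pos (pow_pos 𝔑.G_pos 3) 𝔑.u_pos

/-- `G³u ≤ 1/100`, from `(G³u)⁶ = G¹⁸ η ≤ 10^{-12}`. [cite: FordGreenKonyaginMaynardTao2018, §5 with (4.5)] -/
theorem E0_le : 𝔑.E0 ≤ 1 / 100 := by
  have h6 : 𝔑.E0 ^ 6 ≤ (1 / 100 : ℝ) ^ 6 := by
    have : 𝔑.E0 ^ 6 = 𝔑.G ^ 18 * 𝔑.η := by rw [E0, mul_pow, ← pow_mul, 𝔑.u_pow_six]
    rw [this]; norm_num; linarith [𝔑.hGη]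
  exact le_of_pow_le_pow_left₀ (by norm_num) (by norm_num) h6

/-- [cite: FordGreenKonyaginMaynardTao2018, §5] -/
theorem u_le_E0 : 𝔑.u ≤ 𝔑.E0 := by
  have h : 1 ≤ 𝔑.G ^ 3 := one_le_pow₀ 𝔑.hG
  have := 𝔑.u_pos
  unfold E0; nlinarith

/-- [cite: FordGreenKonyaginMaynardTao2018, §5] -/
theorem u_le : 𝔑.u ≤ 1 / 100 := 𝔑.u_le_E0.trans 𝔑.E0_le

/-- [cite: FordGreenKonyaginMaynardTao2018, §5] -/
theorem u_le_one : 𝔑.u ≤ 1 := 𝔑.u_le.trans (by norm_num)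

/-- [cite: FordGreenKonyaginMaynardTao2018, §5] -/
theorem Gu_le : 𝔑.G * 𝔑.u ≤ 1 / 100 := by
  have h : 𝔑.G ≤ 𝔑.G ^ 3 := le_self_pow₀ 𝔑.hG (by norm_num)
  have := 𝔑.u_pos
  exact le_trans (mul_le_mul_of_nonneg_right h this.le) 𝔑.E0_le

/-- `η = u⁶`. [cite: FordGreenKonyaginMaynardTao2018, §5] -/
theorem η_eq : 𝔑.η = 𝔑.u ^ 6 := 𝔑.u_pow_six.symm

/-- `t = u²`. [cite: FordGreenKonyaginMaynardTao2018, §5] -/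
theorem t_eq : 𝔑.t = 𝔑.u ^ 2 := rfl

/-- `δ ≤ u^{60}`. [cite: FordGreenKonyaginMaynardTao2018, §5 with (4.5)] -/
theorem δ_le_u : 𝔑.δ ≤ 𝔑.u ^ 60 := by
  have := 𝔑.hδη; rw [𝔑.η_eq, ← pow_mul] at this; exact this

/-- `δ ≤ 1`. [cite: FordGreenKonyaginMaynardTao2018, §5] -/
theorem δ_le_one : 𝔑.δ ≤ 1 := 𝔑.δ_le_η.trans 𝔑.η_le_one

/-- `s(τ_M + τ_E) ≤ 2E₀`. [cite: FordGreenKonyaginMaynardTao2018, §5] -/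
theorem Δ_le : 𝔑.s * (𝔑.τM + 𝔑.τE) ≤ 2 * 𝔑.E0 := by
  have hG := 𝔑.hG; have hu := 𝔑.u_pos; have hu1 := 𝔑.u_le_one
  have h1 : 𝔑.s * (𝔑.τM + 𝔑.τE) ≤ 𝔑.G * (𝔑.τM + 𝔑.τE) :=
    mul_le_mul_of_nonneg_right 𝔑.hsG (by linarith [𝔑.τM_pos, 𝔑.τE_pos])
  have h2 : 𝔑.G * (𝔑.τM + 𝔑.τE) = 𝔑.G ^ 2 * 𝔑.u * 𝔑.u + 𝔑.E0 := by
    simp only [τM, τE, E0, 𝔑.t_eq]; ring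
  have h3 : 𝔑.G ^ 2 * 𝔑.u * 𝔑.u ≤ 𝔑.E0 := by
    unfold E0
    have : 𝔑.G ^ 2 * 𝔑.u * 𝔑.u ≤ 𝔑.G ^ 2 * 𝔑.u * 𝔑.G :=
      mul_le_mul_of_nonneg_left (hu1.trans hG) (by positivity)
    linarith
  linarith

/-- `γ ≤ E₀`. [cite: FordGreenKonyaginMaynardTao2018, §5] -/
theorem γ_le_E0 : 𝔑.γ ≤ 𝔑.E0 := by
  have hG := 𝔑.hG; have hu := 𝔑.u_pos; have hu1 := 𝔑.u_le
  have hθi : 0 ≤ 𝔑.θ⁻¹ := inv_nonneg.2 𝔑.hθ0.le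
  have h1 : 𝔑.γ ≤ 2 * 𝔑.G ^ 3 * 𝔑.δ := by
    unfold γ
    have hs2 : 𝔑.s ^ 2 ≤ 𝔑.G ^ 2 := pow_le_pow_left₀ 𝔑.hs 𝔑.hsG 2
    have := mul_le_mul 𝔑.hθG hs2 (sq_nonneg _) (le_trans zero_le_one hG)
    nlinarith [𝔑.hδ]
  have h2 : 𝔑.δ ≤ 𝔑.u ^ 6 := by rw [← 𝔑.η_eq]; exact 𝔑.δ_le_η
  have h3 : 𝔑.u ^ 6 ≤ 𝔑.u / 2 := by
    have : 𝔑.u ^ 5 ≤ (1 / 100) ^ 5 := pow_le_pow_left₀ hu.le hu1 5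
    nlinarith
  unfold E0
  have := pow_pos 𝔑.G_pos 3
  nlinarith

/-- `η ≤ E₀`. [cite: FordGreenKonyaginMaynardTao2018, §5] -/
theorem η_le_E0 : 𝔑.η ≤ 𝔑.E0 := by
  refine le_trans ?_ 𝔑.u_le_E0
  rw [𝔑.η_eq]
  exact pow_le_of_le_one 𝔑.u_pos.le 𝔑.u_le_one (by norm_num)

/-- `2α sD ≤ E₀`. [cite: FordGreenKonyaginMaynardTao2018, §5] -/
theorem αsD_le : 2 * 𝔑.α * (𝔑.s * 𝔑.D) ≤ 𝔑.E0 := by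
  have hG := 𝔑.hG; have hu := 𝔑.u_pos
  have h1 := 𝔑.α_le
  have h2 : 𝔑.s * 𝔑.D ≤ 𝔑.G ^ 2 := by
    rw [sq]; exact mul_le_mul 𝔑.hsG 𝔑.hDG (le_trans zero_le_one 𝔑.hD) (le_trans zero_le_one hG)
  have h3 : 2 * 𝔑.α * (𝔑.s * 𝔑.D) ≤ 4 * 𝔑.G ^ 4 * 𝔑.η := by
    have := mul_le_mul h1 h2 (mul_nonneg 𝔑.hs (le_trans zero_le_one 𝔑.hD))
      (by have := 𝔑.hη0; positivity)
    nlinarith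
  have h4 : 4 * 𝔑.G ^ 4 * 𝔑.η = 4 * 𝔑.E0 * (𝔑.G * 𝔑.u) * 𝔑.u ^ 4 := by
    rw [𝔑.η_eq, E0]; ring
  have h5 : (𝔑.G * 𝔑.u) * 𝔑.u ^ 4 ≤ 1 / 4 := by
    have := 𝔑.Gu_le
    have hu4 : 𝔑.u ^ 4 ≤ 1 := pow_le_one₀ hu.le 𝔑.u_le_one
    have : 0 ≤ 𝔑.G * 𝔑.u := by positivity
    nlinarith
  have := 𝔑.E0_pos
  nlinarith

/-- `ζ/t² ≤ E₀`. [cite: FordGreenKonyaginMaynardTao2018, §5] -/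
theorem ζ_div_le : 𝔑.ζ / 𝔑.t ^ 2 ≤ 𝔑.E0 := by
  have hG := 𝔑.hG; have hu := 𝔑.u_pos; have hu1 := 𝔑.u_le; have hGu := 𝔑.Gu_le
  have hθi : 0 ≤ 𝔑.θ⁻¹ := inv_nonneg.2 𝔑.hθ0.le
  have hG0 := 𝔑.G_pos
  have hδ0 := 𝔑.hδ
  -- ζ ≤ 4G²η + 6G⁵δ + 4G⁶δ²
  have hζ : 𝔑.ζ ≤ 4 * 𝔑.G ^ 2 * 𝔑.η + 6 * 𝔑.G ^ 5 * 𝔑.δ + 4 * 𝔑.G ^ 6 * 𝔑.δ ^ 2 := by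
    unfold ζ
    have hD2 : 𝔑.D ^ 2 ≤ 𝔑.G ^ 2 := pow_le_pow_left₀ (le_trans zero_le_one 𝔑.hD) 𝔑.hDG 2
    have hθ3 : 𝔑.θ⁻¹ ^ 3 ≤ 𝔑.G ^ 3 := pow_le_pow_left₀ hθi 𝔑.hθG 3
    have hθ4 : 𝔑.θ⁻¹ ^ 4 ≤ 𝔑.G ^ 4 := pow_le_pow_left₀ hθi 𝔑.hθG 4
    have hsr : 2 * 𝔑.s + 𝔑.r ≤ 3 * 𝔑.G := by linarith [𝔑.hsG, 𝔑.hrG]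
    have hsr' : 𝔑.s + 𝔑.r ≤ 2 * 𝔑.G := by linarith [𝔑.hsG, 𝔑.hrG]
    have a1 : 4 * 𝔑.η * 𝔑.D ^ 2 ≤ 4 * 𝔑.G ^ 2 * 𝔑.η := by nlinarith [𝔑.hη0]
    have a2 : 2 * 𝔑.θ⁻¹ ^ 3 * 𝔑.δ * 𝔑.D * (2 * 𝔑.s + 𝔑.r) ≤ 6 * 𝔑.G ^ 5 * 𝔑.δ := by
      have := mul_le_mul (mul_le_mul hθ3 𝔑.hDG (le_trans zero_le_one 𝔑.hD) (by positivity)) hsr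
        (by linarith [𝔑.hs, 𝔑.hr]) (by positivity)
      nlinarith
    have a3 : 2 * 𝔑.θ⁻¹ ^ 4 * 𝔑.δ ^ 2 * 𝔑.s * (𝔑.s + 𝔑.r) ≤ 4 * 𝔑.G ^ 6 * 𝔑.δ ^ 2 := by
      have := mul_le_mul (mul_le_mul hθ4 𝔑.hsG 𝔑.hs (by positivity)) hsr'
        (by linarith [𝔑.hs, 𝔑.hr]) (by positivity)
      nlinarith
    linarith
  have ht : 𝔑.t ^ 2 = 𝔑.u ^ 4 := by rw [𝔑.t_eq]; ring
  rw [ht, div_le_iff₀ (pow_pos hu 4)]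
  refine hζ.trans ?_
  have hδu := 𝔑.δ_le_u
  -- each term ≤ E0 u⁴ / 3
  have b1 : 4 * 𝔑.G ^ 2 * 𝔑.η ≤ 𝔑.E0 * 𝔑.u ^ 4 / 3 := by
    rw [𝔑.η_eq, E0]
    have : 4 * 𝔑.G ^ 2 * 𝔑.u ^ 6 = (𝔑.G ^ 3 * 𝔑.u * 𝔑.u ^ 4) * (4 * 𝔑.u / 𝔑.G) := by
      field_simp
    rw [this]
    have h12 : 4 * 𝔑.u / 𝔑.G ≤ 1 / 3 := by
      rw [div_le_iff₀ hG0]; nlinarith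
    have : 0 ≤ 𝔑.G ^ 3 * 𝔑.u * 𝔑.u ^ 4 := by positivity
    nlinarith
  have hu55 : 𝔑.G ^ 3 * 𝔑.u ^ 55 ≤ 1 / 100 := by
    have h1 : 𝔑.G ^ 3 * 𝔑.u ^ 55 = (𝔑.G * 𝔑.u) ^ 3 * 𝔑.u ^ 52 := by ring
    rw [h1]
    have h2 : (𝔑.G * 𝔑.u) ^ 3 ≤ (1 / 100) ^ 3 := pow_le_pow_left₀ (by positivity) hGu 3
    have h3 : 𝔑.u ^ 52 ≤ 1 := pow_le_one₀ hu.le 𝔑.u_le_one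
    have : 0 ≤ (𝔑.G * 𝔑.u) ^ 3 := by positivity
    nlinarith
  have b2 : 6 * 𝔑.G ^ 5 * 𝔑.δ ≤ 𝔑.E0 * 𝔑.u ^ 4 / 3 := by
    have h1 : 6 * 𝔑.G ^ 5 * 𝔑.δ ≤ 6 * 𝔑.G ^ 5 * 𝔑.u ^ 60 :=
      mul_le_mul_of_nonneg_left hδu (by positivity)
    have h2 : 6 * 𝔑.G ^ 5 * 𝔑.u ^ 60 = 𝔑.E0 * 𝔑.u ^ 4 * (6 * (𝔑.G ^ 2 * 𝔑.u ^ 55)) := by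
      rw [E0]; ring
    have h3 : 𝔑.G ^ 2 * 𝔑.u ^ 55 ≤ 𝔑.G ^ 3 * 𝔑.u ^ 55 :=
      mul_le_mul_of_nonneg_right (pow_le_pow_right₀ hG (by norm_num)) (by positivity)
    have : 0 ≤ 𝔑.E0 * 𝔑.u ^ 4 := by have := 𝔑.E0_pos; positivity
    nlinarith
  have b3 : 4 * 𝔑.G ^ 6 * 𝔑.δ ^ 2 ≤ 𝔑.E0 * 𝔑.u ^ 4 / 3 := by
    have h1 : 𝔑.δ ^ 2 ≤ 𝔑.u ^ 60 := by
      rw [sq]; exact le_trans (mul_le_mul 𝔑.δ_le_one hδu hδ0.le zero_le_one) (by rw [one_mul])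
    have h2 : 4 * 𝔑.G ^ 6 * 𝔑.δ ^ 2 ≤ 4 * 𝔑.G ^ 6 * 𝔑.u ^ 60 :=
      mul_le_mul_of_nonneg_left h1 (by positivity)
    have h3 : 4 * 𝔑.G ^ 6 * 𝔑.u ^ 60 = 𝔑.E0 * 𝔑.u ^ 4 * (4 * (𝔑.G ^ 3 * 𝔑.u ^ 55)) := by
      rw [E0]; ring
    have : 0 ≤ 𝔑.E0 * 𝔑.u ^ 4 := by have := 𝔑.E0_pos; positivity
    nlinarith
  linarith

/-- `G³(2t + φ)/u ≤ 6E₀`. [cite: FordGreenKonyaginMaynardTao2018, §5] -/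
theorem G3_err_le : 𝔑.G ^ 3 * (2 * 𝔑.t + 𝔑.φ) / 𝔑.u ≤ 6 * 𝔑.E0 := by
  have hG := 𝔑.hG; have hu := 𝔑.u_pos; have hGu := 𝔑.Gu_le
  have hθi : 0 ≤ 𝔑.θ⁻¹ := inv_nonneg.2 𝔑.hθ0.le
  have hG3 := pow_pos 𝔑.G_pos 3
  rw [div_le_iff₀ hu]
  -- φ ≤ 3u² + 2G²u^{56}
  have hφ : 𝔑.φ ≤ 3 * 𝔑.u ^ 2 + 2 * 𝔑.G ^ 2 * 𝔑.u ^ 56 := by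
    unfold φ
    rw [div_le_iff₀ (pow_pos 𝔑.t_pos 2), 𝔑.t_eq, 𝔑.η_eq]
    have h1 : 𝔑.θ⁻¹ * 𝔑.r * 𝔑.δ ≤ 𝔑.G ^ 2 * 𝔑.u ^ 60 := by
      rw [sq]
      exact mul_le_mul (mul_le_mul 𝔑.hθG 𝔑.hrG (le_trans zero_le_one 𝔑.hr) (le_trans zero_le_one hG))
        𝔑.δ_le_u 𝔑.hδ.le (by positivity)
    nlinarith
  have h2 : 𝔑.G ^ 3 * (2 * 𝔑.t + 𝔑.φ) ≤ 𝔑.G ^ 3 * (2 * 𝔑.u ^ 2 + 3 * 𝔑.u ^ 2 + 2 * 𝔑.G ^ 2 * 𝔑.u ^ 56) := by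
    refine mul_le_mul_of_nonneg_left ?_ hG3.le
    rw [𝔑.t_eq]; linarith
  refine h2.trans ?_
  have h3 : 𝔑.G ^ 3 * (2 * 𝔑.u ^ 2 + 3 * 𝔑.u ^ 2 + 2 * 𝔑.G ^ 2 * 𝔑.u ^ 56) =
      𝔑.E0 * 𝔑.u * (5 + 2 * ((𝔑.G * 𝔑.u) ^ 2 * 𝔑.u ^ 52)) := by rw [E0]; ring
  rw [h3]
  have h4 : (𝔑.G * 𝔑.u) ^ 2 * 𝔑.u ^ 52 ≤ 1 / 2 := by
    have a : (𝔑.G * 𝔑.u) ^ 2 ≤ (1 / 100) ^ 2 := pow_le_pow_left₀ (by positivity) hGu 2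
    have b : 𝔑.u ^ 52 ≤ 1 := pow_le_one₀ hu.le 𝔑.u_le_one
    have : 0 ≤ (𝔑.G * 𝔑.u) ^ 2 := by positivity
    nlinarith
  have hE0 := 𝔑.E0_pos
  have h5 : 5 + 2 * ((𝔑.G * 𝔑.u) ^ 2 * 𝔑.u ^ 52) ≤ 6 := by linarith
  have h6 := mul_le_mul_of_nonneg_left h5 (mul_pos hE0 hu).le
  linarith

/-- `e^{L(e)} ≤ G` for `#e ≤ s`. [cite: FordGreenKonyaginMaynardTao2018, (4.13)] -/
theorem exp_Lsum_le {e : Finset V} (he : (#e : ℝ) ≤ 𝔑.s) : Real.exp (𝔑.Lsum e) ≤ 𝔑.G :=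
  (Real.exp_le_exp.2 (𝔑.Lsum_le he)).trans 𝔑.hexpG

/-- **The bad-event mass is negligible:** `Bd(e) ≤ 7E₀ · P(e)e^{−L(e)}` for `#e ≤ s`.
[cite: FordGreenKonyaginMaynardTao2018, §5 (Lemma 4.1 applied after (5.8))] -/
theorem Bd_le {e : Finset V} (he : (#e : ℝ) ≤ 𝔑.s) :
    𝔑.Bd e ≤ 7 * 𝔑.E0 * (𝔑.P e * Real.exp (-𝔑.Lsum e)) := by
  have hG := 𝔑.hG; have hG0 := 𝔑.G_pos; have hu := 𝔑.u_pos
  have hPe := 𝔑.P_pos e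
  have hθi : 0 ≤ 𝔑.θ⁻¹ := inv_nonneg.2 𝔑.hθ0.le
  have hPG : 1 ≤ 𝔑.G * 𝔑.P e := by
    have := 𝔑.hPG e he
    change 1 / 𝔑.P e ≤ 𝔑.G at this
    rw [div_le_iff₀ hPe] at this; linarith
  have hexp : 1 ≤ 𝔑.G * Real.exp (-𝔑.Lsum e) := by
    have h1 := 𝔑.exp_Lsum_le he
    have h2 : Real.exp (𝔑.Lsum e) * Real.exp (-𝔑.Lsum e) = 1 := by
      rw [← Real.exp_add, add_neg_cancel, Real.exp_zero]
    nlinarith [Real.exp_pos (-𝔑.Lsum e)]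
  -- G · Bd ≤ P(e) (ζ/t² + G³(2t+φ)/u)
  have hζt := 𝔑.ζ_div_le
  have herr := 𝔑.G3_err_le
  have hcard : (#e : ℝ) ≤ 𝔑.G := he.trans 𝔑.hsG
  have hζ0 := 𝔑.ζ_nonneg; have hφ0 := 𝔑.φ_nonneg; have ht0 := 𝔑.t_pos
  have hT1 : 𝔑.G * (#e * (𝔑.P e * 𝔑.ζ / 𝔑.τM ^ 2)) ≤ 𝔑.P e * 𝔑.E0 := by
    have h1 : 𝔑.G * (#e * (𝔑.P e * 𝔑.ζ / 𝔑.τM ^ 2)) ≤ 𝔑.G * (𝔑.G * (𝔑.P e * 𝔑.ζ / 𝔑.τM ^ 2)) :=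
      mul_le_mul_of_nonneg_left (mul_le_mul_of_nonneg_right hcard (by have := 𝔑.τM_pos; positivity))
        hG0.le
    have h2 : 𝔑.G * (𝔑.G * (𝔑.P e * 𝔑.ζ / 𝔑.τM ^ 2)) = 𝔑.P e * (𝔑.ζ / 𝔑.t ^ 2) := by
      simp only [τM]; field_simp
    rw [h2] at h1
    exact h1.trans (mul_le_mul_of_nonneg_left hζt hPe.le)
  have hT2 : 𝔑.G * (#e * (𝔑.θ⁻¹ * (2 * 𝔑.t + 𝔑.φ) * 𝔑.D / 𝔑.τE)) ≤ 𝔑.P e * (6 * 𝔑.E0) := by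
    have h1 : #e * (𝔑.θ⁻¹ * (2 * 𝔑.t + 𝔑.φ) * 𝔑.D / 𝔑.τE) ≤
        𝔑.G * (𝔑.G * (2 * 𝔑.t + 𝔑.φ) * 𝔑.G / 𝔑.τE) := by
      refine mul_le_mul hcard ?_ (by have := 𝔑.τE_pos; have := 𝔑.hD; positivity) hG0.le
      refine div_le_div_of_nonneg_right ?_ 𝔑.τE_pos.le
      exact mul_le_mul (mul_le_mul_of_nonneg_right 𝔑.hθG (by positivity)) 𝔑.hDG
        (le_trans zero_le_one 𝔑.hD) (by positivity)
    have h2 : 𝔑.G * (𝔑.G * (𝔑.G * (2 * 𝔑.t + 𝔑.φ) * 𝔑.G / 𝔑.τE)) =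
        𝔑.G ^ 2 * (2 * 𝔑.t + 𝔑.φ) / 𝔑.u := by
      simp only [τE]; field_simp
    have h3 := mul_le_mul_of_nonneg_left h1 hG0.le
    rw [h2] at h3
    refine h3.trans ?_
    have hq0 : 0 ≤ 𝔑.G ^ 2 * (2 * 𝔑.t + 𝔑.φ) / 𝔑.u := by positivity
    have h4 : 𝔑.G ^ 2 * (2 * 𝔑.t + 𝔑.φ) / 𝔑.u ≤ (𝔑.G * 𝔑.P e) * (𝔑.G ^ 2 * (2 * 𝔑.t + 𝔑.φ) / 𝔑.u) :=
      le_mul_of_one_le_left hq0 hPG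
    have h5 : (𝔑.G * 𝔑.P e) * (𝔑.G ^ 2 * (2 * 𝔑.t + 𝔑.φ) / 𝔑.u) =
        𝔑.P e * (𝔑.G ^ 3 * (2 * 𝔑.t + 𝔑.φ) / 𝔑.u) := by ring
    rw [h5] at h4
    exact h4.trans (mul_le_mul_of_nonneg_left herr hPe.le)
  have hGBd : 𝔑.G * 𝔑.Bd e ≤ 𝔑.P e * (7 * 𝔑.E0) := by
    unfold Bd; rw [mul_add, mul_add]; linarith
  -- divide by G and use e^{-L} ≥ 1/G
  have hE0 := 𝔑.E0_pos
  have hBd0 := 𝔑.Bd_nonneg e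
  have : 𝔑.Bd e ≤ 𝔑.Bd e * (𝔑.G * Real.exp (-𝔑.Lsum e)) := by nlinarith
  refine this.trans ?_
  have h := mul_le_mul_of_nonneg_right hGBd (Real.exp_pos (-𝔑.Lsum e)).le
  nlinarith

/-- **The one-step estimate (conclusion (5.6) ⇒ (4.14) at level `m`):** for `#e ≤ s`,
`E 1_{e ⊆ 𝐖} Y(𝐖) = (1 + O_≤(20 G³ η^{1/6})) P_{m−1}(e) e^{−∑_{v∈e} d(v)/P_{m−1}(v)}`.
[cite: FordGreenKonyaginMaynardTao2018, §5 pp. 19–21 (proof of Theorem 3, inductive step)] -/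
theorem step {e : Finset V} (he : (#e : ℝ) ≤ 𝔑.s) :
    |𝔑.E (fun ω => 𝔑.ind e ω * 𝔑.Y e (𝔑.W ω)) - 𝔑.P e * Real.exp (-𝔑.Lsum e)| ≤
      20 * 𝔑.E0 * (𝔑.P e * Real.exp (-𝔑.Lsum e)) := by
  set A := 𝔑.P e * Real.exp (-𝔑.Lsum e) with hA
  set Z := 𝔑.E (fun ω => 𝔑.ind e ω * 𝔑.Y e (𝔑.W ω)) with hZ
  have hA0 : 0 < A := mul_pos (𝔑.P_pos e) (Real.exp_pos _)
  have hE0 := 𝔑.E0_pos; have hE01 := 𝔑.E0_le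
  have hΔ := 𝔑.Δ_le; have hγ := 𝔑.γ_le_E0; have hη := 𝔑.η_le_E0; have hαsD := 𝔑.αsD_le
  have hBd := 𝔑.Bd_le he; have hBd0 := 𝔑.Bd_nonneg e
  have hη0 := 𝔑.hη0; have hα0 := 𝔑.α_nonneg; have hα1 := 𝔑.α_le_half
  have hΔ0 : 0 ≤ 𝔑.s * (𝔑.τM + 𝔑.τE) := mul_nonneg 𝔑.hs (by linarith [𝔑.τM_pos, 𝔑.τE_pos])
  have hγ0 := 𝔑.γ_nonneg
  have hL0 := 𝔑.Lsum_nonneg e; have hLsD := 𝔑.Lsum_le he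
  -- upper deviation
  have hup : Z - A ≤ 16 * 𝔑.E0 * A := by
    have h1 := 𝔑.E_ind_Y_le he
    set x' := 𝔑.s * (𝔑.τM + 𝔑.τE) + 𝔑.γ with hx'
    have hx'0 : 0 ≤ x' := by linarith
    have hx'1 : x' ≤ 1 := by linarith
    have hexp : Real.exp (-𝔑.Lsum e + 𝔑.s * (𝔑.τM + 𝔑.τE) + 𝔑.γ) * ((1 + 𝔑.η) * 𝔑.P e) =
        A * (Real.exp x' * (1 + 𝔑.η)) := by
      rw [hA, hx', show -𝔑.Lsum e + 𝔑.s * (𝔑.τM + 𝔑.τE) + 𝔑.γ =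
        -𝔑.Lsum e + (𝔑.s * (𝔑.τM + 𝔑.τE) + 𝔑.γ) by ring, Real.exp_add]; ring
    rw [hexp] at h1
    have h2 := exp_mul_one_add_sub_one_le hx'0 hx'1 hη0.le
    have h3 : A * (Real.exp x' * (1 + 𝔑.η)) - A ≤ A * (2 * x' + 3 * 𝔑.η) := by nlinarith
    nlinarith
  -- lower deviation
  have hlo : A - Z ≤ 13 * 𝔑.E0 * A := by
    have h1 := 𝔑.le_E_ind_Y he
    set x := 2 * 𝔑.α * 𝔑.Lsum e + (1 + 2 * 𝔑.α) * (𝔑.s * (𝔑.τM + 𝔑.τE)) with hx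
    have hx0 : 0 ≤ x := by rw [hx]; positivity
    have hexp : Real.exp (-((1 + 2 * 𝔑.α) * (𝔑.Lsum e + 𝔑.s * (𝔑.τM + 𝔑.τE)))) =
        Real.exp (-𝔑.Lsum e) * Real.exp (-x) := by
      rw [← Real.exp_add, hx]; ring_nf
    rw [hexp] at h1
    have hex1 : Real.exp (-x) ≤ 1 := by rw [Real.exp_le_one_iff]; linarith
    have hex0 := Real.exp_pos (-x)
    have heL0 := Real.exp_pos (-𝔑.Lsum e)
    have h2 := one_sub_exp_neg_mul_le hx0 hη0.le
    -- A − Z ≤ A(1 − e^{-x}(1−η)) + e^{-L}e^{-x} Bd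
    have h3 : A - Z ≤ A * (1 - Real.exp (-x) * (1 - 𝔑.η)) +
        Real.exp (-𝔑.Lsum e) * Real.exp (-x) * 𝔑.Bd e := by
      have : Real.exp (-𝔑.Lsum e) * Real.exp (-x) * ((1 - 𝔑.η) * 𝔑.P e - 𝔑.Bd e) =
          A * (Real.exp (-x) * (1 - 𝔑.η)) - Real.exp (-𝔑.Lsum e) * Real.exp (-x) * 𝔑.Bd e := by
        rw [hA]; ring
      linarith
    have h4 : Real.exp (-𝔑.Lsum e) * Real.exp (-x) * 𝔑.Bd e ≤ 𝔑.Bd e := by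
      have a : Real.exp (-𝔑.Lsum e) ≤ 1 := by rw [Real.exp_le_one_iff]; linarith
      have : Real.exp (-𝔑.Lsum e) * Real.exp (-x) ≤ 1 := by nlinarith
      nlinarith
    have hxle : x ≤ 2 * 𝔑.α * (𝔑.s * 𝔑.D) + 2 * (𝔑.s * (𝔑.τM + 𝔑.τE)) := by
      rw [hx]
      have a := mul_le_mul_of_nonneg_left hLsD (by positivity : 0 ≤ 2 * 𝔑.α)
      have b : (1 + 2 * 𝔑.α) * (𝔑.s * (𝔑.τM + 𝔑.τE)) ≤ 2 * (𝔑.s * (𝔑.τM + 𝔑.τE)) :=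
        mul_le_mul_of_nonneg_right (by linarith) hΔ0
      linarith
    have h5 : A * (1 - Real.exp (-x) * (1 - 𝔑.η)) ≤ A * (x + 𝔑.η) := mul_le_mul_of_nonneg_left h2 hA0.le
    nlinarith
  rw [abs_le]
  constructor <;> nlinarith

end Numerics

end NibbleData

end FGKMTCovering

end Literature.Combinatorics.Hypergraph
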